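import Summits.QuantumFields.YangMills.Theorems.SmallFieldWideningLargeFieldMassRefinementTailOfHeightTail
import Summits.QuantumFields.YangMills.Theorems.SmallFieldWideningLargeFieldMassRefinementTailAveragedTailOfIntCoreRec
import Summits.QuantumFields.YangMills.Theorems.UnitScaleTiltHistoryTailLaneTailChi

/-!
# Route `SmallFieldWidening` — crux r3 `LargeFieldMassRefinementTail` (stmt-QuantumFields-22884) MODULO THE K2-L SOCKET OF RECORD
# `AlphaInputsT3AC.IntCoreRec` (support file, leaf; width seats `ym-line-sfw-p2-w2` ∘ `-w3`)

The composition of the two landed width-seat files of line `birth`: w3's `LargeFieldMassRefinementTail.averagedTailPkg_of_intCoreRec`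
(p579116: the record-free interior socket `IntCoreRec L` of the K2-L programme of route `UnitScaleTilt` at every odd block size `L > 1` gives the
per-family averaged-height tail package `∀ L, ∃ (b₀, p₀), ∃ γ₁ ≤ 1, ∀ F (F.L = L) ∀ 0 < γ ≤ γ₁, AveragedTailAt F γ b₀ p₀`) and w2's bridge
`LargeFieldMassRefinementTailOfHeightTail.largeFieldMassRefinementTail_of_averagedTail` (p579220: that package gives the crux BY NAME — run `K` of
`F.refine n` at `γL^{-n}` is run `n + K` of `F` with `n` free top steps, so no family-uniform constants are needed).  Hence
**`largeFieldMassRefinementTail_of_intCoreRec : (∀ L, Odd L → 1 < L → IntCoreRec L) → LargeFieldMassRefinementTail`** — crux r3 is closed the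
hour the K2-L socket is inhabited; it carries no large-deviation content of its own.  Kept in its own leaf because it imports the `UnitScaleTilt` cone.

WHAT THIS IS NOT: `IntCoreRec` is OPEN (the located, unprinted renormalisation-group content of [Balaban1985UV3] (41)/(47)/(71)); nothing here
bears on the Yang–Mills mass gap (rung R3 record only).
-/

noncomputable section

open Literature.MathematicalPhysics.QuantumFieldTheory.Balaban1983to89
open Summit.QuantumFields.YangMills.Theorems.LargeFieldMassRefinementTail (averagedTailPkg_of_intCoreRec)
open Summit.QuantumFields.YangMills.Theorems.LargeFieldMassRefinementTailOfHeightTail (largeFieldMassRefinementTail_of_averagedTail)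

namespace Summit.QuantumFields.YangMills.Theorems.LargeFieldMassRefinementTailOfIntCoreRec

/-- **r3 ⇐ THE K2-L SOCKET OF RECORD**: if the record-free interior socket `AlphaInputsT3AC.IntCoreRec L` is inhabited at every odd block size
`L > 1`, then `LargeFieldMassRefinementTail` holds (w3's package theorem composed with w2's level-shift bridge).
[cite: Balaban1985UV3, (7) p.257 and (71) p.273] -/
theorem largeFieldMassRefinementTail_of_intCoreRec
    (hrec : ∀ L : ℕ, Odd L → 1 < L → AlphaInputsT3AC.IntCoreRec L) :
    Summit.QuantumFields.YangMills.Theses.SmallFieldWidening.LargeFieldMassRefinementTail :=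
  largeFieldMassRefinementTail_of_averagedTail (averagedTailPkg_of_intCoreRec hrec)

/-! ## Appended (width seat `ym-line-sfw-p2-w3`): the two neighbouring currencies of the same socket

* the THRESHOLD-FORM per-plaquette high tail (the common conclusion shape of the tree's `perPlaquetteHighL_of_laneRecords` /
  `perPlaquetteHighL_of_intCoreRec`), through `LargeFieldMassRefinementTail.averagedTailPkg_of_perPlaquetteHighL` (p579116);
* the χ-RECORD `AlphaInputsT3ACv3RecChi L` at every odd `L > 1` — the registered text of 19936's successor stub `stub_laneRecordsV3chi`
  (skeleton v5p9 = {2′χ}); through the tree's `HistoryTailLaneTailChi.intCoreRec_of_laneRecordsChi`.  The closer the lead cites the hour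
  that stub lands: `exact largeFieldMassRefinementTail_of_laneRecordsChi stub_laneRecordsV3chi`. -/

/-- **r3 ⇐ THE THRESHOLD-FORM PER-PLAQUETTE HIGH TAIL** (for every odd `L > 1` and all thresholds `(b₁, p₁)`: a profile beyond them, collar
exponents `r₀, κ ≥ 0` with `1 + 3r₀/2 < p₀`, a small-factor constant `0 < c ≤ ¼`, a threshold `0 < γ₁ ≤ 1`, and per family/coupling a
height `j₀` and constants `(C, A)` bounding the Gibbs tail of every averaged plaquette at the heights `j > j₀` by
`C·β^A·exp(−c·p² + κ·(1 + log g⁻¹)^{2+3r₀})`): `LargeFieldMassRefinementTail`. [cite: Balaban1985UV3, (7) p.257 and (71) p.273] -/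
theorem largeFieldMassRefinementTail_of_perPlaquetteHighL
    (hhighL : ∀ (L : ℕ), Odd L → 1 < L → ∀ (b₁ p₁ : ℝ),
      ∃ b₀ p₀ r₀ κ c : ℝ, b₁ ≤ b₀ ∧ p₁ ≤ p₀ ∧ 0 < b₀ ∧ 2 < p₀ ∧ 0 ≤ r₀ ∧ 0 ≤ κ ∧ 1 + 3 * r₀ / 2 < p₀ ∧ 0 < c ∧ c ≤ 1 / 4 ∧
        ∃ γ₁ : ℝ, 0 < γ₁ ∧ γ₁ ≤ 1 ∧
          ∀ (F : T3ContinuumYM3Torus.T3Family) (γ : ℝ), F.L = L → 0 < γ → γ ≤ γ₁ →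
            ∃ (j₀ : ℕ) (C : ℝ) (A : ℕ), 0 ≤ C ∧
              ∀ (K j : ℕ), j₀ < j → j ≤ K → ∀ p : Plaq (F.P K) j,
                (T3UnitScaleTilt.gibbsK F T3UnitLawDensityEML.ℰp γ K).real
                    {U | T3UnitScaleTilt.θBal F.L γ b₀ p₀ (K - j) ≤
                      GaugeGroup.dist1 (GaugeField.plaqHol
                        (Averaging.iter (fun _ => BlockAveraging.blockAvg T3UnitLawDensityEML.ℰp) j U) p)} ≤
                  C * (F.scheme T3UnitLawDensityEML.ℰp γ).β (K - j) ^ A *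
                    Real.exp (-(c * B10.pFun b₀ p₀ (Real.sqrt (γ * ((F.L : ℝ)⁻¹) ^ (K - j))) ^ 2) +
                      κ * (1 + Real.log (Real.sqrt (γ * ((F.L : ℝ)⁻¹) ^ (K - j)))⁻¹) ^ (2 + 3 * r₀))) :
    Summit.QuantumFields.YangMills.Theses.SmallFieldWidening.LargeFieldMassRefinementTail :=
  largeFieldMassRefinementTail_of_averagedTail (LargeFieldMassRefinementTail.averagedTailPkg_of_perPlaquetteHighL hhighL)

/-- **r3 ⇐ THE χ-RECORD** (`AlphaInputsT3ACv3RecChi L` for every odd `L > 1`, the registered text of 19936's successor stub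
`stub_laneRecordsV3chi`; `HistoryTailLaneTailChi.intCoreRec_of_laneRecordsChi`): `LargeFieldMassRefinementTail`.
[cite: Balaban1985UV3, (5) p.256, (47) p.267 and (71) p.273] -/
theorem largeFieldMassRefinementTail_of_laneRecordsChi
    (hrec : ∀ L : ℕ, Odd L → 1 < L → Summit.QuantumFields.YangMills.Theorems.AlphaInputsT3ACv3RecChi L) :
    Summit.QuantumFields.YangMills.Theses.SmallFieldWidening.LargeFieldMassRefinementTail :=
  largeFieldMassRefinementTail_of_intCoreRec fun L hLo hL =>
    HistoryTailLaneTailChi.intCoreRec_of_laneRecordsChi L (hrec L hLo hL)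

end Summit.QuantumFields.YangMills.Theorems.LargeFieldMassRefinementTailOfIntCoreRec

end
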